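import Summits.ResolutionOfSingularities.ResolutionOfSingularities.Theorems.FrobeniusLadderFInjectiveMacaulayficationTrOfResolution
import Summits.ResolutionOfSingularities.ResolutionOfSingularities.Theorems.FrobeniusLadderFInjectiveMacaulayficationDimSliceTrOne
import HarnessLib

/-!
# THE F-LADDER SPLIT OF THE T-HALF: door v38's resolution stub ⟸ the F-half ∧ RESOLUTION OF FULL VARIETIES over `k(X₁,…,X_r)`
# (crux `FInjectiveMacaulayfication` stmt-ResolutionOfSingularities-15315, chain w45a; CHAIN v31.4 §(4) «E4 attack: the first typed reduction of T(p,4,1)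
# with both halves typed»; seat res-L1-w45a-stub-3 g9, object O2 over O1 `TrOfResolution` p612760)

[OURS · L1 W4.5a] Support file (`--supports stmt-ResolutionOfSingularities-15315 --as helper`); replaces the role of NO printed item; NOT a statement of
any manuscript; TWO definitions (`@[conjecture] def FullBlowupTr`, `@[conjecture] def ResolutionFullTr`, OURS candidates, consumed only as hypotheses; no
instance, no notation, no named fact) and theorems CONDITIONAL on four published theorems BY NAME (`CossartPiltant2019General` = CP 2019 Thm. 1.1,
`Stacks081R` = Raynaud–Gruson, `CossartPiltant2019Principalization` = CP 2019 Prop. 4.4, `CesnaviciusBlowupMacaulayficationOffClosed` = Česnavičius 2021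
Thm. 5.3 reading (B), Literature p602953) and on the chain's CANDIDATE statements. AI-written (AI review is weaker than expert review).

THE SPLIT. `TrOfResolution` (p612760) placed the T-half below resolution: `ResolutionTr p e r → ClosedPointLocalResolutionAdmTr p e r`. Resolution of an
`e`-fold `Y` over `K = k(X₁,…,X_r)` splits along the route's own ladder into
  (a) `FullBlowupTr p e r` — ONE blowing up `Y′ → Y` with centre in `Sing Y` and FULL source (locally integral, Cohen–Macaulay, parameter ideals
      Frobenius-closed: the crux's stalk clause `SliceableCentre.FullCl`), and
  (b) `ResolutionFullTr p e r` — resolution (Temkin Def. 2.2.6) of the FULL `e`-folds over `K`,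
composed by Temkin's Lemma 2.1.4 (Stacks 080B, in the tree `IsBlowup.exists_isBlowup_comp_supported`): §2 `resolutionTr_of_fullBlowup_of_resolutionFull`.
Half (a) is NOT new residue: by res-L1-w45a-stub-3's `DimSliceCM.exists_isBlowup_full_of_cm_of_rungs_of_F` it is a THEOREM at every level `e ≥ 4` modulo the
four prints ∧ the rungs `T(p,e′,r′)` at the levels `4 ≤ e′ < e` ∧ the F-half AT LEVEL `e` (§3 `fullBlowupTr_of_cm_of_rungs_of_F`, every `r`). Strong induction
on the level (§4 `tr_le_of_cesnaviciusOffClosed_of_F_of_resolutionFull`) therefore gives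

  ★★ {T(p,e,r)}_{4 ≤ e ≤ n, r ≥ 1} ⟸ four prints ∧ {F(e)}_{4 ≤ e ≤ n} ∧ {ResolutionFullTr p e r}_{4 ≤ e ≤ n, r ≥ 1},

and the door terms (§5–§6, `r = 1` by res-L1-w45a-lead-1's tower isomorphism `nonempty_ringEquiv_fractionRing_tower`):

  ★★★ `fInjectiveMacaulayfication_of_cesnaviciusOffClosed_of_LFadmF_of_resolutionFullOne (hG h081R hP hM) (hLF : LocalFInjectivizationFibreAdmGe4)
        (hRF1 : ∀ p e, p.Prime → 4 ≤ e → ResolutionFullTr p e 1) : Theses.FrobeniusLadder.FInjectiveMacaulayfication`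

— door v38's `_proof` shape with the resolution stub `stub_closedPointLocalResolutionAdmTr` replaced by **resolution of FULL (F-injective Cohen–Macaulay,
locally integral) `e`-folds over `k(s)`, `e ≥ 4`**: after the F-half the resolution side only ever sees FULL input. §7: the `d = 5` slice
(`…_dimLe5_…`: four prints ∧ F(4) ∧ F(5) ∧ `ResolutionFullTr p 4 1`) and ★★ resolution itself along the ladder
(`resolutionTr_of_cesnaviciusOffClosed_of_F_of_resolutionFull`: `ResolutionTr p e r` ⟸ four prints ∧ F(4 … e) ∧ `ResolutionFullTr` at the levels `≤ e`).

HONEST CAVEATS. (1) Modulo the F-half, (b) is EQUIVALENT to `ResolutionTr` (that is what a reduction is); resolution of F-injective Cohen–Macaulay 4-folds in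
characteristic `p` is open. (2) `ResolutionFullTr` is WEAKER as a hypothesis than resolution restricted to F-rational varieties would be a conclusion — FULL
(parameter ideals Frobenius-closed) is implied by, not equivalent to, F-rationality; it is NOT the route's rung `FRationalResolution` (stmt-…-15317). (3) The
wild specimens of the chain's F-half census (E₈-type, `z² + λz + g` at `p = 2`, T⁽⁴⁾/7) are NOT FULL — they are exactly what (b) no longer sees.
[folklore assembly; cite: Temkin2008, Lemma 2.1.4, Def. 2.2.6, Def. 2.3.1, Prop. 2.3.4] [cite: StacksProject, Tag 080B; Tag 02OS] [cite: CossartPiltant2019, Thm. 1.1 (i)(ii); Prop. 4.4]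
[cite: Cesnavicius2021, Thm. 5.3] [cite: RaynaudGruson1971, Thm. 5.2.2]
-/

-- single-problem summit: the doubled namespace component is forced
set_option linter.dupNamespace false

noncomputable section

namespace Summit.ResolutionOfSingularities.ResolutionOfSingularities.Theorems.FInjectiveMacaulayfication.TrOfResolutionFull

open CategoryTheory CategoryTheory.Limits AlgebraicGeometry TopologicalSpace IsLocalRing
open Literature.AlgebraicGeometry.Resolution
open Summit.ResolutionOfSingularities.ResolutionOfSingularities.Theorems.FInjectiveMacaulayfication
open SliceableCentre ClosedPointLocalResolutionAdmTr TrOfResolution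

/-! ## §1 The two halves of resolution over `k(X₁,…,X_r)` along the F-ladder -/

/-- [OURS · CANDIDATE statement] **`FullBlowupTr p e r` — a SINGULAR-LOCUS-SUPPORTED BLOWING UP WITH FULL SOURCE**: for every field `k` of characteristic
`p`, `K := FractionRing (MvPolynomial (Fin r) k)`, every integral separated finite-type `e`-fold `Y` over `K` has a blowing up `Y′ → Y` along some `J ≠ ⊥`
with `Supp J ⊆ Sing Y` whose source is FULL at every stalk (`SliceableCentre.FullCl p`: domain ∧ Cohen–Macaulay ∧ parameter ideals Frobenius-closed —
the crux's stalk clause verbatim). A THEOREM at every level `e ≥ 4` modulo {CP 1.1, 081R, CP 4.4, Česnavičius 5.3} ∧ the rungs `T(p,e′,r′)`, `4 ≤ e′ < e`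
∧ the F-half at level `e` (§3, = res-L1-w45a-stub-3's `DimSliceCM.exists_isBlowup_full_of_cm_of_rungs_of_F`). [candidate statement, OURS;
cite: Temkin2008, Def. 2.2.6; CossartPiltant2019, Thm. 1.1] -/
@[conjecture] def FullBlowupTr (p e r : ℕ) : Prop :=
  ∀ (k : Type) [Field k] [CharP k p] (Y : Scheme.{0}) (g : Y ⟶ Spec (.of (FractionRing (MvPolynomial (Fin r) k)))),
    IsSeparated g → LocallyOfFiniteType g → QuasiCompact g → IsIntegral Y → topologicalKrullDim Y = e →
    ∃ (Y' : Scheme.{0}) (π : Y' ⟶ Y) (J : Y.IdealSheafData), IsBlowup π J ∧ J ≠ ⊥ ∧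
      (J.support : Set Y) ⊆ (Scheme.regularLocus Y)ᶜ ∧ ∀ y' : Y', FullCl p (Y'.presheaf.stalk y')

/-- [OURS · CANDIDATE statement] **`ResolutionFullTr p e r` — RESOLUTION OF FULL `e`-FOLDS OVER `k(X₁,…,X_r)`**: for every field `k` of characteristic `p`,
`K := FractionRing (MvPolynomial (Fin r) k)`, every integral separated finite-type `e`-fold `Y` over `K` ALL OF WHOSE STALKS ARE FULL (locally integral,
Cohen–Macaulay, parameter ideals Frobenius-closed — i.e. F-injective Cohen–Macaulay) admits a desingularization (Temkin Def. 2.2.6). `ResolutionTr p e r`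
restricted to FULL input; open for `e ≥ 4`. [candidate statement, OURS; cite: Temkin2008, Def. 2.3.1; Def. 2.2.6] -/
@[conjecture] def ResolutionFullTr (p e r : ℕ) : Prop :=
  ∀ (k : Type) [Field k] [CharP k p] (Y : Scheme.{0}) (g : Y ⟶ Spec (.of (FractionRing (MvPolynomial (Fin r) k)))),
    IsSeparated g → LocallyOfFiniteType g → QuasiCompact g → IsIntegral Y → topologicalKrullDim Y = e →
    (∀ y : Y, FullCl p (Y.presheaf.stalk y)) → Scheme.AdmitsDesingularization Y

/-- Resolution of all `e`-folds gives resolution of the FULL ones. [plumbing] -/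
theorem resolutionFullTr_of_resolutionTr {p e r : ℕ} (h : ResolutionTr p e r) : ResolutionFullTr p e r :=
  fun k _ _ Y g hs hl hq hi hd _ => h k Y g hs hl hq hi hd

/-! ## §2 Composition: FULL blowing up, then resolution of the FULL model -/

/-- ★ **`ResolutionTr p e r` ⟸ `FullBlowupTr p e r` ∧ `ResolutionFullTr p e r`.** Blow `Y` up along `J ≠ ⊥`, `Supp J ⊆ Sing Y`, to a FULL `Y′` (again an
integral separated finite-type `e`-fold over `K`: `IsBlowup.isIntegral`, `IsBlowup.isProper`, `IsBirational.topologicalKrullDim_eq_of_isProper`);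
desingularize `Y′` by `Y″ = Bl_{J′} Y′ → Y′`, `Supp J′ ⊆ Sing Y′ ⊆ π⁻¹(Sing Y)` (a blowing up is an isomorphism off its centre, `IsBlowup.isIso_compl`);
the composite is ONE blowing up of `Y` along a centre supported in `Sing Y` (Temkin Lemma 2.1.4 = Raynaud, Stacks 080B, in the tree:
`IsBlowup.exists_isBlowup_comp_supported`) with regular source. [folklore assembly; cite: Temkin2008, Lemma 2.1.4; Def. 2.2.6] [cite: StacksProject, Tag 080B; Tag 02OS] -/
theorem resolutionTr_of_fullBlowup_of_resolutionFull {p e r : ℕ} (hB : FullBlowupTr p e r) (hR : ResolutionFullTr p e r) :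
    ResolutionTr p e r := by
  intro k _ _ Y g hs hl hq hi hd
  haveI := hs; haveI := hl; haveI := hq
  haveI : IsLocallyNoetherian Y := LocallyOfFiniteType.isLocallyNoetherian g
  haveI : CompactSpace Y := QuasiCompact.compactSpace_of_compactSpace g
  haveI : IsNoetherian Y := {}
  obtain ⟨Y', π, J, hπ, hJ, hJs, hfull⟩ := hB k Y g hs hl hq hi hd
  haveI : IsIntegral Y' := hπ.isIntegral hJ
  haveI : IsProper π := hπ.isProper
  have hd' : topologicalKrullDim Y' = e := by rw [(hπ.isBirational' hJ).topologicalKrullDim_eq_of_isProper, hd]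
  obtain ⟨Y'', ρ, hdes⟩ := hR k Y' (π ≫ g) inferInstance inferInstance inferInstance inferInstance hd' hfull
  obtain ⟨J', hρ, hJ's⟩ := hdes.exists_isBlowup
  -- `Sing Y′ ⊆ π⁻¹(Sing Y)`: `π` is an isomorphism off `Supp J ⊆ Sing Y`
  have hJ'T : (J'.support : Set Y') ⊆ π ⁻¹' (Scheme.regularLocus Y)ᶜ := by
    intro y' hy' hreg
    have h1 : π y' ∉ (J.support : Set Y) := fun h => hJs h hreg
    haveI := hπ.isIso_compl
    exact hJ's hy' ((mem_regularLocus_iff_of_isIso_morphismRestrict π ⟨(J.support : Set Y)ᶜ, J.support.isClosed.isOpen_compl⟩ y' h1).mpr hreg)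
  obtain ⟨Q, hQ, hQs⟩ := hπ.exists_isBlowup_comp_supported π J ρ J' (Scheme.regularLocus Y)ᶜ hJs hρ hJ'T
  exact ⟨Y'', ρ ≫ π, ⟨Q, hQ, hQs⟩, hdes.isRegular⟩

/-- ★ **`ClosedPointLocalResolutionAdmTr p e r` ⟸ `FullBlowupTr p e r` ∧ `ResolutionFullTr p e r`** (through `TrOfResolution`). [folklore assembly] -/
theorem tr_of_fullBlowup_of_resolutionFull {p e r : ℕ} (hB : FullBlowupTr p e r) (hR : ResolutionFullTr p e r) :
    ClosedPointLocalResolutionAdmTr p e r :=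
  closedPointLocalResolutionAdmTr_of_resolutionTr (resolutionTr_of_fullBlowup_of_resolutionFull hB hR)

/-! ## §3 The FULL blowing up at level `e` from the prints, the lower rungs and the F-half at level `e` -/

/-- ★ **`FullBlowupTr p e r` (every `r`) ⟸ {CP 1.1, 081R, CP 4.4} ∧ a CM-centre supplier ∧ the rungs `T(p,e′,r′)` (`4 ≤ e′ < e`, `r′ ≥ 1`) ∧ the F-half AT
LEVEL `e`** (`4 ≤ e`): res-L1-w45a-stub-3's `DimSliceCM.exists_isBlowup_full_of_cm_of_rungs_of_F` over the field `k(X₁,…,X_r)`. [OURS · conditional-result]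
[cite: Temkin2008, Prop. 2.3.4] [cite: CossartPiltant2019, Thm. 1.1; Prop. 4.4] [cite: Cesnavicius2021, Thm. 5.3] -/
theorem fullBlowupTr_of_cm_of_rungs_of_F
    (hG : CossartPiltant2019General.{0}) (h081R : Stacks081R.{0}) (hP : CossartPiltant2019Principalization.{0})
    (hCM : ∀ (p : ℕ), p.Prime → ∀ {k : Type} [Field k] [CharP k p] {X : Scheme.{0}} (f : X ⟶ Spec (.of k))
      [LocallyOfFiniteType f] [IsIntegral X] (x : X), ringKrullDim (X.presheaf.stalk x) ≠ 0 →
      ∀ (S' : Scheme.{0}) (g : S' ⟶ Spec (X.presheaf.stalk x)) (I : (Spec (X.presheaf.stalk x)).IdealSheafData),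
        I ≠ ⊥ → IsBlowup g I → (∀ s : S', g.base s ≠ closedPoint (X.presheaf.stalk x) → s ∈ Scheme.regularLocus S') →
        ∃ 𝓚 : S'.IdealSheafData, 𝓚 ≠ ⊥ ∧ (∀ s ∈ (𝓚.support : Set S'), g.base s = closedPoint (X.presheaf.stalk x)) ∧
          ∀ (S'' : Scheme.{0}) (π : S'' ⟶ S'), IsBlowup π 𝓚 → ∀ s : S'', IsDomain (S''.presheaf.stalk s) ∧ CMCl (S''.presheaf.stalk s))
    {p e : ℕ} (hp : p.Prime) (h4 : 4 ≤ e)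
    (hRlt : ∀ e' r' : ℕ, 4 ≤ e' → e' + 1 ≤ e → 1 ≤ r' → ClosedPointLocalResolutionAdmTr p e' r')
    (hFe : ∀ (k : Type) [Field k] [CharP k p] (X : Scheme.{0}) (f : X ⟶ Spec (.of k)),
      IsSeparated f → LocallyOfFiniteType f → QuasiCompact f → IsIntegral X →
      ∀ x : X, IsClosed ({x} : Set X) → x ∉ Scheme.regularLocus X → ringKrullDim (X.presheaf.stalk x) = e →
      ∀ (S' : Scheme.{0}) (g : S' ⟶ Spec (X.presheaf.stalk x)) (I : (Spec (X.presheaf.stalk x)).IdealSheafData),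
        I ≠ ⊥ → (I.support : Set (Spec (X.presheaf.stalk x))) ⊆ (Scheme.regularLocus (Spec (X.presheaf.stalk x)))ᶜ → IsBlowup g I →
        (∀ s : S', g.base s ≠ closedPoint (X.presheaf.stalk x) → s ∈ Scheme.regularLocus S') →
        (∀ s : S', CMCl (S'.presheaf.stalk s)) →
        ∃ 𝓚 : S'.IdealSheafData, 𝓚 ≠ ⊥ ∧ (∀ s ∈ (𝓚.support : Set S'), g.base s = closedPoint (X.presheaf.stalk x)) ∧
          ∀ (S'' : Scheme.{0}) (π : S'' ⟶ S'), IsBlowup π 𝓚 → ∀ s : S'', FullCl p (S''.presheaf.stalk s))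
    (r : ℕ) : FullBlowupTr p e r := by
  intro k _ _ Y g hs hl hq hi hd
  haveI := hs; haveI := hl; haveI := hq
  haveI := NonClosedPointChart.charP_fractionRing_mvPolynomial p k r
  exact DimSliceCM.exists_isBlowup_full_of_cm_of_rungs_of_F hG h081R hP hCM h4 p hp hRlt (fun k _ _ X f => hFe k X f) _ Y g hd

/-! ## §4 The induction on the level: the whole T-half from the F-half and resolution of FULL varieties -/

/-- ★★ **THE LEVEL-`e` RUNG FROM THE F-HALF AND RESOLUTION OF FULL VARIETIES** (strong induction on `e`): with {CP 1.1, 081R, CP 4.4, Česnavičius 5.3 (B)}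
BY NAME, the F-half at the levels `4 … e` and `ResolutionFullTr p e′ r′` at the levels `4 ≤ e′ ≤ e` (`r′ ≥ 1`): `ClosedPointLocalResolutionAdmTr p e r` for
every `r ≥ 1`. Step: T(p,e,r) ⟸ `ResolutionTr p e r` (`TrOfResolution`) ⟸ `FullBlowupTr p e r` (§3, fed by the induction hypothesis at the levels `< e`)
∧ `ResolutionFullTr p e r`. [OURS · conditional-result] [cite: Temkin2008, Prop. 2.3.4; Lemma 2.1.4] [cite: CossartPiltant2019, Thm. 1.1; Prop. 4.4]
[cite: Cesnavicius2021, Thm. 5.3] -/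
theorem tr_le_of_cesnaviciusOffClosed_of_F_of_resolutionFull (n : ℕ)
    (hG : CossartPiltant2019General.{0}) (h081R : Stacks081R.{0}) (hP : CossartPiltant2019Principalization.{0})
    (hM : CesnaviciusBlowupMacaulayficationOffClosed.{0}) {p : ℕ} (hp : p.Prime)
    (hF : ∀ e : ℕ, 4 ≤ e → e ≤ n → ∀ (k : Type) [Field k] [CharP k p] (X : Scheme.{0}) (f : X ⟶ Spec (.of k)),
      IsSeparated f → LocallyOfFiniteType f → QuasiCompact f → IsIntegral X →
      ∀ x : X, IsClosed ({x} : Set X) → x ∉ Scheme.regularLocus X → ringKrullDim (X.presheaf.stalk x) = e →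
      ∀ (S' : Scheme.{0}) (g : S' ⟶ Spec (X.presheaf.stalk x)) (I : (Spec (X.presheaf.stalk x)).IdealSheafData),
        I ≠ ⊥ → (I.support : Set (Spec (X.presheaf.stalk x))) ⊆ (Scheme.regularLocus (Spec (X.presheaf.stalk x)))ᶜ → IsBlowup g I →
        (∀ s : S', g.base s ≠ closedPoint (X.presheaf.stalk x) → s ∈ Scheme.regularLocus S') →
        (∀ s : S', CMCl (S'.presheaf.stalk s)) →
        ∃ 𝓚 : S'.IdealSheafData, 𝓚 ≠ ⊥ ∧ (∀ s ∈ (𝓚.support : Set S'), g.base s = closedPoint (X.presheaf.stalk x)) ∧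
          ∀ (S'' : Scheme.{0}) (π : S'' ⟶ S'), IsBlowup π 𝓚 → ∀ s : S'', FullCl p (S''.presheaf.stalk s))
    (hRF : ∀ e r : ℕ, 4 ≤ e → e ≤ n → 1 ≤ r → ResolutionFullTr p e r) :
    ∀ e r : ℕ, 4 ≤ e → e ≤ n → 1 ≤ r → ClosedPointLocalResolutionAdmTr p e r := by
  intro e
  induction e using Nat.strong_induction_on with
  | _ e ih =>
    intro r h4 hen hr
    refine tr_of_fullBlowup_of_resolutionFull ?_ (hRF e r h4 hen hr)
    exact fullBlowupTr_of_cm_of_rungs_of_F hG h081R hP (DimSliceOfCesnavicius.cmSupplier_of_cesnaviciusOffClosed hM) hp h4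
      (fun e' r' h4' hlt hr' => ih e' (by omega) r' h4' (by omega) hr') (hF e h4 hen) r

/-- ★★ **DOOR v38's RESOLUTION STUB ⟸ four published theorems ∧ the F-half ∧ resolution of FULL varieties over `k(X₁,…,X_r)`:**
`stub_closedPointLocalResolutionAdmTr` ⟸ {CP 1.1, 081R, CP 4.4, Česnavičius 5.3 (B)} ∧ `LocalFInjectivizationFibreAdmGe4` ∧ {ResolutionFullTr p e r}_{e ≥ 4, r ≥ 1}.
[OURS · conditional-result] [cite: Temkin2008, Prop. 2.3.4; Lemma 2.1.4] [cite: CossartPiltant2019, Thm. 1.1; Prop. 4.4] [cite: Cesnavicius2021, Thm. 5.3] -/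
theorem stubTr_of_cesnaviciusOffClosed_of_LFadmF_of_resolutionFull
    (hG : CossartPiltant2019General.{0}) (h081R : Stacks081R.{0}) (hP : CossartPiltant2019Principalization.{0})
    (hM : CesnaviciusBlowupMacaulayficationOffClosed.{0})
    (hLF : LocalFullificationFibreAdmGe4Split.LocalFInjectivizationFibreAdmGe4)
    (hRF : ∀ p e r : ℕ, p.Prime → 4 ≤ e → 1 ≤ r → ResolutionFullTr p e r) :
    ∀ p e r : ℕ, p.Prime → 4 ≤ e → 1 ≤ r → ClosedPointLocalResolutionAdmTr p e r :=
  fun p e r hp he hr => tr_le_of_cesnaviciusOffClosed_of_F_of_resolutionFull e hG h081R hP hM hp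
    (fun e' h4 _ => hLF e' h4 p hp) (fun e' r' h4 _ hr' => hRF p e' r' hp h4 hr') e r he le_rfl hr

/-! ## §5 The door terms: the crux from the prints, the F-half and resolution of FULL varieties -/

/-- ★★★ **THE ROUTE DECL ⟸ {CP 2019 Thm 1.1, Stacks 081R, CP 2019 Prop 4.4, Česnavičius 2021 Thm 5.3 (B)} BY NAME ∧ the F-half `LocalFInjectivizationFibreAdmGe4`
∧ RESOLUTION OF FULL VARIETIES over `k(X₁,…,X_r)` (`e ≥ 4`, `r ≥ 1`)** — door v38's `_proof` term with the resolution stub pushed onto FULL (locally integral,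
Cohen–Macaulay, F-injective) input only. [OURS · conditional-result: conditional on four published theorems BY NAME and on the CANDIDATE statements]
[cite: Cesnavicius2021, Thm. 5.3] [cite: CossartPiltant2019, Thm. 1.1 (i)(ii); Prop. 4.4] [cite: RaynaudGruson1971, Thm. 5.2.2] [cite: Temkin2008, Prop. 2.3.4] -/
theorem fInjectiveMacaulayfication_of_cesnaviciusOffClosed_of_LFadmF_of_resolutionFull
    (hG : CossartPiltant2019General.{0}) (h081R : Stacks081R.{0}) (hP : CossartPiltant2019Principalization.{0})
    (hM : CesnaviciusBlowupMacaulayficationOffClosed.{0})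
    (hLF : LocalFullificationFibreAdmGe4Split.LocalFInjectivizationFibreAdmGe4)
    (hRF : ∀ p e r : ℕ, p.Prime → 4 ≤ e → 1 ≤ r → ResolutionFullTr p e r) :
    Summit.ResolutionOfSingularities.ResolutionOfSingularities.Theses.FrobeniusLadder.FInjectiveMacaulayfication :=
  OfTrRungs.fInjectiveMacaulayfication_of_trRungs_of_cesnaviciusOffClosed hG h081R hP hM
    (stubTr_of_cesnaviciusOffClosed_of_LFadmF_of_resolutionFull hG h081R hP hM hLF hRF) hLF

/-! ## §6 Transcendence monotonicity: `r = 1` carries the FULL-resolution input -/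

/-- **Monotonicity of `ResolutionFullTr` in `r`** (as `ClosedPointLocalResolutionAdmTrMono`: an `e`-fold over `k(s₁,…,s_{j+r})` is one over `k′(s₁,…,s_j)`,
`k′ = k(t₁,…,t_r)`, along `Spec` of res-L1-w45a-lead-1's tower isomorphism `nonempty_ringEquiv_fractionRing_tower`). [folklore] -/
theorem resolutionFullTr_mono {p e j : ℕ} (h : ResolutionFullTr p e j) (r : ℕ) : ResolutionFullTr p e (j + r) := by
  intro k _ _ Y g hs hl hq hi hd hfull
  obtain ⟨φ⟩ := ClosedPointLocalResolutionAdmTrMono.nonempty_ringEquiv_fractionRing_tower k j r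
  haveI := NonClosedPointChart.charP_fractionRing_mvPolynomial p k r
  let ι : Spec (.of (FractionRing (MvPolynomial (Fin (j + r)) k))) ⟶
      Spec (.of (FractionRing (MvPolynomial (Fin j) (FractionRing (MvPolynomial (Fin r) k))))) :=
    Spec.map φ.toCommRingCatIso.hom
  haveI : IsIso ι := inferInstance
  haveI := hs; haveI := hl; haveI := hq
  exact h (FractionRing (MvPolynomial (Fin r) k)) Y (g ≫ ι) inferInstance inferInstance inferInstance hi hd hfull

/-- **`r = 1` alone carries the FULL-resolution input of the door.** [folklore] -/
theorem forall_resolutionFullTr_of_one (h : ∀ p e : ℕ, p.Prime → 4 ≤ e → ResolutionFullTr p e 1) :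
    ∀ p e r : ℕ, p.Prime → 4 ≤ e → 1 ≤ r → ResolutionFullTr p e r := by
  intro p e r hp he hr
  obtain ⟨r₀, rfl⟩ := Nat.exists_eq_add_of_le hr
  exact resolutionFullTr_mono (h p e hp he) r₀

/-- ★★★ **THE ROUTE DECL ⟸ four published theorems ∧ the F-half ∧ {`ResolutionFullTr p e 1`}_{p prime, e ≥ 4}**: resolution of FULL `e`-folds over `k(s)` — ONE
transcendental — is the only resolution input left. [OURS · conditional-result] [cite: Cesnavicius2021, Thm. 5.3] [cite: CossartPiltant2019, Thm. 1.1 (i)(ii); Prop. 4.4]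
[cite: Temkin2008, Prop. 2.3.4] -/
theorem fInjectiveMacaulayfication_of_cesnaviciusOffClosed_of_LFadmF_of_resolutionFullOne
    (hG : CossartPiltant2019General.{0}) (h081R : Stacks081R.{0}) (hP : CossartPiltant2019Principalization.{0})
    (hM : CesnaviciusBlowupMacaulayficationOffClosed.{0})
    (hLF : LocalFullificationFibreAdmGe4Split.LocalFInjectivizationFibreAdmGe4)
    (hRF1 : ∀ p e : ℕ, p.Prime → 4 ≤ e → ResolutionFullTr p e 1) :
    Summit.ResolutionOfSingularities.ResolutionOfSingularities.Theses.FrobeniusLadder.FInjectiveMacaulayfication :=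
  fInjectiveMacaulayfication_of_cesnaviciusOffClosed_of_LFadmF_of_resolutionFull hG h081R hP hM hLF (forall_resolutionFullTr_of_one hRF1)

/-! ## §7 The per-dimension slice at `d = 5` and resolution itself -/

/-- ★ **dim ≤ 5 ⟸ four published theorems ∧ F(4) ∧ F(5) ∧ `ResolutionFullTr p 4 1`** (over res-L1-w45a-lead-1's `DimSliceTrOne`): on 5-folds the only
resolution input of the door is resolution of FULL 4-folds over `k(s)`. [OURS · conditional-result] [cite: Cesnavicius2021, Thm. 5.3]
[cite: CossartPiltant2019, Thm. 1.1; Prop. 4.4] [cite: Temkin2008, Prop. 2.3.4] -/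
theorem fInjectiveMacaulayfication_dimLe5_of_cesnaviciusOffClosed_of_resolutionFull41_of_F45
    (hG : CossartPiltant2019General.{0}) (h081R : Stacks081R.{0}) (hP : CossartPiltant2019Principalization.{0})
    (hM : CesnaviciusBlowupMacaulayficationOffClosed.{0})
    (hRF41 : ∀ p : ℕ, p.Prime → ResolutionFullTr p 4 1)
    (hF4 : ∀ (p : ℕ), p.Prime → ∀ (k : Type) [Field k] [CharP k p]
    (X : Scheme.{0}) (f : X ⟶ Spec (.of k)),
      IsSeparated f → LocallyOfFiniteType f → QuasiCompact f → IsIntegral X →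
      ∀ x : X, IsClosed ({x} : Set X) → x ∉ Scheme.regularLocus X → ringKrullDim (X.presheaf.stalk x) = 4 →
      ∀ (S' : Scheme.{0}) (g : S' ⟶ Spec (X.presheaf.stalk x)) (I : (Spec (X.presheaf.stalk x)).IdealSheafData),
        I ≠ ⊥ → (I.support : Set (Spec (X.presheaf.stalk x))) ⊆ (Scheme.regularLocus (Spec (X.presheaf.stalk x)))ᶜ → IsBlowup g I →
        (∀ s : S', g.base s ≠ closedPoint (X.presheaf.stalk x) → s ∈ Scheme.regularLocus S') →
        (∀ s : S', CMCl (S'.presheaf.stalk s)) →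
        ∃ 𝓚 : S'.IdealSheafData, 𝓚 ≠ ⊥ ∧ (∀ s ∈ (𝓚.support : Set S'), g.base s = closedPoint (X.presheaf.stalk x)) ∧
          ∀ (S'' : Scheme.{0}) (π : S'' ⟶ S'), IsBlowup π 𝓚 → ∀ s : S'', FullCl p (S''.presheaf.stalk s))
    (hF5 : ∀ (p : ℕ), p.Prime → ∀ (k : Type) [Field k] [CharP k p]
    (X : Scheme.{0}) (f : X ⟶ Spec (.of k)),
      IsSeparated f → LocallyOfFiniteType f → QuasiCompact f → IsIntegral X →
      ∀ x : X, IsClosed ({x} : Set X) → x ∉ Scheme.regularLocus X → ringKrullDim (X.presheaf.stalk x) = 5 →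
      ∀ (S' : Scheme.{0}) (g : S' ⟶ Spec (X.presheaf.stalk x)) (I : (Spec (X.presheaf.stalk x)).IdealSheafData),
        I ≠ ⊥ → (I.support : Set (Spec (X.presheaf.stalk x))) ⊆ (Scheme.regularLocus (Spec (X.presheaf.stalk x)))ᶜ → IsBlowup g I →
        (∀ s : S', g.base s ≠ closedPoint (X.presheaf.stalk x) → s ∈ Scheme.regularLocus S') →
        (∀ s : S', CMCl (S'.presheaf.stalk s)) →
        ∃ 𝓚 : S'.IdealSheafData, 𝓚 ≠ ⊥ ∧ (∀ s ∈ (𝓚.support : Set S'), g.base s = closedPoint (X.presheaf.stalk x)) ∧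
          ∀ (S'' : Scheme.{0}) (π : S'' ⟶ S'), IsBlowup π 𝓚 → ∀ s : S'', FullCl p (S''.presheaf.stalk s)) :
    ∀ p : ℕ, p.Prime → ∀ (k : Type) [Field k] [CharP k p] (X : Scheme.{0}) (f : X ⟶ Spec (.of k)),
      IsSeparated f → LocallyOfFiniteType f → QuasiCompact f → IsReduced X → topologicalKrullDim X ≤ 5 →
      ∃ (X' : Scheme.{0}) (π : X' ⟶ X), IsProper π ∧ IsBirational π ∧ ∀ x : X',
        IsDomain (X'.presheaf.stalk x) ∧ ∀ d : ℕ, ringKrullDim (X'.presheaf.stalk x) = d →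
          ∀ s : Fin d → X'.presheaf.stalk x, (Ideal.span (Set.range s)).radical.IsMaximal →
            RingTheory.Sequence.IsWeaklyRegular (X'.presheaf.stalk x) (List.ofFn s) ∧
            ∀ y : X'.presheaf.stalk x, (∃ e : ℕ, y ^ p ^ e ∈ Ideal.span
              ((fun z : X'.presheaf.stalk x => z ^ p ^ e) ''
                (Ideal.span (Set.range s) : Set (X'.presheaf.stalk x)))) →
              y ∈ Ideal.span (Set.range s) :=
  DimSliceTrOne.fInjectiveMacaulayfication_dimLe5_of_cesnaviciusOffClosed_of_tr41_of_F45 hG h081R hP hM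
    (fun p hp => tr_le_of_cesnaviciusOffClosed_of_F_of_resolutionFull 4 hG h081R hP hM hp
      (fun e h4 he4 => by obtain rfl : e = 4 := le_antisymm he4 h4; exact hF4 p hp)
      (fun e r h4 he4 hr => by
        obtain rfl : e = 4 := le_antisymm he4 h4
        obtain ⟨r₀, rfl⟩ := Nat.exists_eq_add_of_le hr
        exact resolutionFullTr_mono (hRF41 p hp) r₀) 4 1 le_rfl le_rfl le_rfl)
    hF4 hF5

/-- ★★ **RESOLUTION ITSELF along the F-ladder**: `ResolutionTr p e r` — resolution of ALL integral separated finite-type `e`-folds over `k(X₁,…,X_r)` (`r = 0`: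
over every field `k` of characteristic `p`, up to `Frac(k[∅]) ≅ k`) — ⟸ four published theorems ∧ the F-half at the levels `4 … e` ∧ resolution of FULL
varieties: `ResolutionFullTr p e r` at the top level and `ResolutionFullTr p e′ 1` at the levels `4 ≤ e′ < e`. [OURS · conditional-result]
[cite: Temkin2008, Prop. 2.3.4; Lemma 2.1.4] [cite: CossartPiltant2019, Thm. 1.1; Prop. 4.4] [cite: Cesnavicius2021, Thm. 5.3] -/
theorem resolutionTr_of_cesnaviciusOffClosed_of_F_of_resolutionFull {e : ℕ} (h4 : 4 ≤ e)
    (hG : CossartPiltant2019General.{0}) (h081R : Stacks081R.{0}) (hP : CossartPiltant2019Principalization.{0})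
    (hM : CesnaviciusBlowupMacaulayficationOffClosed.{0}) {p : ℕ} (hp : p.Prime)
    (hF : ∀ e' : ℕ, 4 ≤ e' → e' ≤ e → ∀ (k : Type) [Field k] [CharP k p] (X : Scheme.{0}) (f : X ⟶ Spec (.of k)),
      IsSeparated f → LocallyOfFiniteType f → QuasiCompact f → IsIntegral X →
      ∀ x : X, IsClosed ({x} : Set X) → x ∉ Scheme.regularLocus X → ringKrullDim (X.presheaf.stalk x) = e' →
      ∀ (S' : Scheme.{0}) (g : S' ⟶ Spec (X.presheaf.stalk x)) (I : (Spec (X.presheaf.stalk x)).IdealSheafData),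
        I ≠ ⊥ → (I.support : Set (Spec (X.presheaf.stalk x))) ⊆ (Scheme.regularLocus (Spec (X.presheaf.stalk x)))ᶜ → IsBlowup g I →
        (∀ s : S', g.base s ≠ closedPoint (X.presheaf.stalk x) → s ∈ Scheme.regularLocus S') →
        (∀ s : S', CMCl (S'.presheaf.stalk s)) →
        ∃ 𝓚 : S'.IdealSheafData, 𝓚 ≠ ⊥ ∧ (∀ s ∈ (𝓚.support : Set S'), g.base s = closedPoint (X.presheaf.stalk x)) ∧
          ∀ (S'' : Scheme.{0}) (π : S'' ⟶ S'), IsBlowup π 𝓚 → ∀ s : S'', FullCl p (S''.presheaf.stalk s))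
    (hRF1 : ∀ e' : ℕ, 4 ≤ e' → e' + 1 ≤ e → ResolutionFullTr p e' 1) {r : ℕ} (hRFe : ResolutionFullTr p e r) :
    ResolutionTr p e r := by
  refine resolutionTr_of_fullBlowup_of_resolutionFull ?_ hRFe
  refine fullBlowupTr_of_cm_of_rungs_of_F hG h081R hP (DimSliceOfCesnavicius.cmSupplier_of_cesnaviciusOffClosed hM) hp h4 ?_ (hF e h4 le_rfl) r
  intro e' r' h4' hlt hr'
  obtain ⟨r₀, rfl⟩ := Nat.exists_eq_add_of_le hr'
  refine tr_le_of_cesnaviciusOffClosed_of_F_of_resolutionFull (e - 1) hG h081R hP hM hp (fun n hn hne => hF n hn (by omega))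
    (fun n m hn hne hm => ?_) e' (1 + r₀) h4' (by omega) hr'
  obtain ⟨m₀, rfl⟩ := Nat.exists_eq_add_of_le hm
  exact resolutionFullTr_mono (hRF1 n hn (by omega)) m₀

end Summit.ResolutionOfSingularities.ResolutionOfSingularities.Theorems.FInjectiveMacaulayfication.TrOfResolutionFull

end
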